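import Summits.HodgeConjecture.HodgeConjecture.Theorems.F0P3aStubS1TraceFunctional
import Literature.NumberTheory.Automorphic.AutomorphicQuotientDiagonalTrace
import Literature.NumberTheory.Automorphic.CompactQuotientFiniteMultiplicity
import Literature.NumberTheory.Automorphic.AdelicUnitaryGroupDatum
import HarnessLib

/-!
# Crux `H413`, floor 0, programme F0P3a — the T1 closers S1 (trace functional) and A2 (finite multiplicities) AT EVERY RANK `N`

Cell hodgecm-mathlib (D-0151); director s454 ruling D1 = R1 «make the T-letters `N`-generic wherever the proof is uniform in `N` (state once,
instantiate at 2 and 3)»; pen A-p04 (g21) (free hand from P5, F0P5-plan (g2) desk word #5); PROOF lane `--supports stmt-HodgeConjecture-24833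
--as helper`; THEOREMS ONLY (no definition, no instance, no notation, no named fact, no `sorry`); count-neutral.

The two closers of line `Cruxes/H413/Lines/F0_T1InnerFormTraceIdentity.lean` that are typed at `cmDatum L 3 H` although their engines are
rank-free — ★ `F0P3aStubS1TraceFunctional.stubS1_holds` (over the generic ★ `exists_traceFunctional`) and ★ `F0P3aFactA2Multiplicity.
factT1a_multiplicityFinite` (over ★ `UnitaryGroup.multiplicity_lt_top_of_mem_discreteSpectrum_cmDatum`) — restated and proved VERBATIM with
`3 ↦ N`, `H : Matrix (Fin N) (Fin N) L`, so that an `N`-generic statement layer folds `StubT1aTraceFunctional`∕`FactT1aMultiplicityFinite` BY NAME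
at every `N` (and the `N = 2` edition serving P5's sockets E1₂∕E3hol₂ in particular).  Inputs, all ★ and rank-generic:
`UnitaryGroup.compactSpace_cmDatum_automorphicQuotient L N H`, `UnitaryGroup.discreteTopology_cmDatum_quotientSubgroup L N H`,
`F0P3aStubS1TraceFunctional.exists_traceFunctional` (any adelic group datum with compact quotient), `multiplicity_lt_top_of_mem_discreteSpectrum_cmDatum`.

References: [Rogawski1990] §14.5 p. 237 («Since `G′` is anisotropic, `T_{G′}(f′)` is the trace of `ρ(f′)` on `L(G′)`»); [Gelbart1975] (9.11), Lemma
10.6; [DeitmarEchterhoff2014] Thm. 9.2.2; [GelfandGraevPiatetskiShapiro1969] Ch. 1 §2.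
-/

set_option autoImplicit false
-- the mandated namespace has the single-problem summit's repeated segment (`HodgeConjecture.HodgeConjecture`)
set_option linter.dupNamespace false

noncomputable section

namespace Summit.HodgeConjecture.HodgeConjecture.Cruxes.H413.F0P3aT1ClosersAtN

open MeasureTheory Measure NumberField
open Literature.NumberTheory.Automorphic
open Literature.MeasureTheory.Group
open Literature.AlgebraicGeometry.ShimuraVarieties (hermForm)

variable (L : Type) [Field L] [NumberField L] [IsCMField L] (N : ℕ) (H : Matrix (Fin N) (Fin N) L)

/-- **STUB S1 of line `F0_T1InnerFormTraceIdentity` AT RANK `N`, proved** — for anisotropic `H ∈ M_N(L)` over the CM field `L`, any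
automorphic measure `μ` and any inversion-invariant Haar measure `ν` on `U(H)(𝔸_{L⁺})`: the trace functional `θ(F) = c⁻¹ ∫_X K_F(x, x) dμ`
(kernel for the counting measure on the discrete subgroup `U(H)(L⁺)`; ★ `exists_traceFunctional` at `cmDatum L N H`, compactness
★ `compactSpace_cmDatum_automorphicQuotient`) is `ℂ`-linear on `C_c(U(H)(𝔸_{L⁺}), ℂ)` and reproduces the Hilbert–Schmidt norm
`Σ_i ‖R(f′) e_i‖²` on every `f′ ⋆ f′^*`, with vanishing imaginary part — the statement of ★ `F0P3aStubS1TraceFunctional.stubS1_holds` with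
`3 ↦ N` token for token. [cite: Rogawski1990, §14.5 p. 237] [cite: Gelbart1975, (9.11) and Lemma 10.6] -/
theorem stubS1_holds_rank [MeasurableSpace (UnitaryGroup.cmDatum L N H).Adelic] [BorelSpace (UnitaryGroup.cmDatum L N H).Adelic]
    (μ : Measure (UnitaryGroup.cmDatum L N H).automorphicQuotient) [(UnitaryGroup.cmDatum L N H).IsAutomorphicMeasure μ]
    (ν : Measure (UnitaryGroup.cmDatum L N H).Adelic) [ν.IsHaarMeasure] [ν.IsInvInvariant] :
    (∀ x : Fin N → L, hermForm (cmConjRingHom L) H x x = 0 → x = 0) →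
    ∃ θ : CompactlySupportedContinuousMap (UnitaryGroup.cmDatum L N H).Adelic ℂ →ₗ[ℂ] ℂ,
      ∀ (f' F' : CompactlySupportedContinuousMap (UnitaryGroup.cmDatum L N H).Adelic ℂ),
        (∀ x, F' x = mulConv ν (⇑f') (mulStar (⇑f')) x) →
        ∀ {ι : Type} [Countable ι] (b : HilbertBasis ι ℂ ((UnitaryGroup.cmDatum L N H).L2 μ)),
          HasSum (fun i => (‖((UnitaryGroup.cmDatum L N H).rightRegular μ).integratedOperator
              ((UnitaryGroup.cmDatum L N H).isUnitary_rightRegular μ)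
              ((UnitaryGroup.cmDatum L N H).isStronglyContinuous_rightRegular_holds μ) ν f' (b i)‖ ^ 2 : ℝ))
            (θ F').re ∧ (θ F').im = 0 := by
  intro hanis
  haveI : CompactSpace (UnitaryGroup.cmDatum L N H).automorphicQuotient :=
    UnitaryGroup.compactSpace_cmDatum_automorphicQuotient L N H hanis
  haveI : DiscreteTopology (UnitaryGroup.cmDatum L N H).quotientSubgroup :=
    UnitaryGroup.discreteTopology_cmDatum_quotientSubgroup L N H
  haveI hH : IsClosed ((UnitaryGroup.cmDatum L N H).quotientSubgroup : Set (UnitaryGroup.cmDatum L N H).Adelic) :=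
    Subgroup.isClosed_of_discrete
  haveI : Countable (UnitaryGroup.cmDatum L N H).quotientSubgroup :=
    TopologicalSpace.separableSpace_iff_countable.1 inferInstance
  haveI : IsFiniteMeasureOnCompacts (Measure.count : Measure (UnitaryGroup.cmDatum L N H).quotientSubgroup) :=
    ⟨fun k hk => Measure.count_apply_lt_top.2 hk.finite_of_discrete⟩
  exact F0P3aStubS1TraceFunctional.exists_traceFunctional (UnitaryGroup.cmDatum L N H) μ
    (Measure.count : Measure (UnitaryGroup.cmDatum L N H).quotientSubgroup) ν (NeZero.ne _)

/-- **Anchor fact A2 of the T1 line AT RANK `N`, proved** — for anisotropic `H ∈ M_N(L)` and any automorphic measure `μ`, every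
discrete automorphic representation of `U(H)` has finite multiplicity in `L²(μ)`: the statement of
★ `F0P3aFactA2Multiplicity.factT1a_multiplicityFinite` with `3 ↦ N`; the proof is ★ `UnitaryGroup.multiplicity_lt_top_of_mem_discreteSpectrum_cmDatum`.
[cite: Rogawski1990, §14.5 p. 237] [cite: DeitmarEchterhoff2014, Thm. 9.2.2] -/
theorem factT1a_multiplicityFinite_rank
    (μ : Measure (UnitaryGroup.cmDatum L N H).automorphicQuotient) [(UnitaryGroup.cmDatum L N H).IsAutomorphicMeasure μ] :
    (∀ x : Fin N → L, hermForm (cmConjRingHom L) H x x = 0 → x = 0) →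
      multiplicity_lt_top_of_mem_discreteSpectrum (UnitaryGroup.cmDatum L N H) μ :=
  fun hanis => UnitaryGroup.multiplicity_lt_top_of_mem_discreteSpectrum_cmDatum L N H hanis μ

/-- **S1 is non-vacuous at every rank**: every test function `f′ ∈ C_c(U(H)(𝔸_{L⁺}), ℂ)` has a compactly supported continuous `F′ = f′ ⋆ f′^*`
to feed `stubS1_holds_rank` (★ `F0P3aStubS1TraceFunctional.mulConvMulStar_nonvacuous` at `cmDatum L N H`). [cite: Gelbart1975, Lemma 10.6] -/
theorem mulConvMulStar_nonvacuous_rank [MeasurableSpace (UnitaryGroup.cmDatum L N H).Adelic] [BorelSpace (UnitaryGroup.cmDatum L N H).Adelic]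
    (ν : Measure (UnitaryGroup.cmDatum L N H).Adelic) [ν.IsHaarMeasure]
    (f' : CompactlySupportedContinuousMap (UnitaryGroup.cmDatum L N H).Adelic ℂ) :
    ∃ F' : CompactlySupportedContinuousMap (UnitaryGroup.cmDatum L N H).Adelic ℂ, ∀ x, F' x = mulConv ν (⇑f') (mulStar (⇑f')) x :=
  F0P3aStubS1TraceFunctional.mulConvMulStar_nonvacuous ν f'

end Summit.HodgeConjecture.HodgeConjecture.Cruxes.H413.F0P3aT1ClosersAtN

end
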